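import Literature.Analysis.Approximation.RealExponentialSumZerosProofs

/-!
# `MatrixDescartes` census — DOOR A at `(3,4)`: JUNCTION CLUSTERS of the large-gap limit — the three-term extended exponential sum
# `p_A(s) + e^s·p_B(s) + e^{2s}·p_C(s)` has at most `deg p_A + deg p_B + deg p_C + 2` zeros (Braess VI §1 Lemma 1.1, extended case)

HONEST FRAMING.  Object-search cell `pub-symmetroid`, engine seat `val-sym-eng-2` (g11); helper row beside the registered strata line `Cruxes/DoorA34/Lines/strata.lean`
on stmt-ValiantsHypothesis-19980 (`DoorA34 = PosRootLawAt 3 4 18`: OPEN, typed, never asserted here).  The seat's LARGE-GAP LAW (report HOME/DOOR-A34-ENG2G11-REPORT.md §3,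
paper-level): with the three blocks `A = det G`, `B = tr(adj G·S₃)`, `C = tr(adj S₃·G)` of a null-top pencil FIXED and the gap `N → ∞` (top-letter scale `h` free),
`det = A + h·x^N·B + h²·x^{2N}·C` has eventually at most `Z₊(A) + Z₊(C) + 2` positive roots; away from ONE balance point `u* = ln x*` one block dominates, and in the
cluster `x = x*·e^{s/N}` the determinant converges (after normalisation) to a three-term EXTENDED EXPONENTIAL SUM `p_A(s) + e^s·p_B(s) + e^{2s}·p_C(s)`, `deg p_X` = the
multiplicity of the blocks' roots at `x*`.  The counting engine of that step is D. Braess, *Nonlinear Approximation Theory* (1986), Ch. VI §1 Lemma 1.1 for extended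
sums — typed and proved by this seat as `Literature.Analysis.Approximation.Braess1986_VI_1_1_extended(_holds)`.  This file records its three-term instance in the
census namespace, so that the cluster bound is citable by name:

* `junctionCluster_zeros_le` — for real polynomials `p_A, p_B, p_C` the function `s ↦ p_A(s) + p_B(s)·e^{s} + p_C(s)·e^{2s}` on `ℝ` is identically zero or has a finite
  zero set with at most `Σ_{p_X ≠ 0}(deg p_X + 1) − 1` elements (`≤ deg p_A + deg p_B + deg p_C + 2` when all three are non-zero);
* `junctionCluster_const_zeros_le_two` — the generic junction (`p_A, p_B, p_C` non-zero constants): at most `2` zeros — the «+2 junctions» of every window anatomy.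

Nothing here bounds the sheet (the passage from the pencil to the cluster limit is asymptotic and not typed); `DoorA34` and the three stubs stay OPEN; registers unchanged
(`ζ_sym(3,4) ∈ {18,19}`); nothing on `MatrixDescartes` (stmt-ValiantsHypothesis-18050) or on `VP ≠ VNP` — VP≠VNP not moved.
[cite: Braess1986, Ch. VI §1 Lemma 1.1 (p. 158), extended sums of display (1.3)] via the Literature fact; elementary instantiation.
-/

-- `Summit.ValiantsHypothesis.ValiantsHypothesis.…` repeats a component by the D-0017 layout
-- (single-conjunct summit), which the `dupNamespace` linter flags; the name is mandated.
set_option linter.dupNamespace false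

namespace Summit.ValiantsHypothesis.ValiantsHypothesis.Theorems.LacunarySymmetroidMatrixDescartes.Census

open Polynomial
open Literature.Analysis.Approximation (Braess1986_VI_1_1_extended_holds)

/-- **JUNCTION CLUSTERS.**  For real polynomials `p_A, p_B, p_C`, the three-term extended exponential sum `s ↦ p_A(s) + p_B(s)·e^{s} + p_C(s)·e^{2s}` is identically zero
on `ℝ`, or its zero set is finite with at most `Σ_{X : p_X ≠ 0} (deg p_X + 1) − 1` elements.  (Braess VI §1 Lemma 1.1, extended case, with exponents `0, 1, 2`.) [folklore] -/
theorem junctionCluster_zeros_le (pA pB pC : ℝ[X]) :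
    (∀ s : ℝ, pA.eval s + pB.eval s * Real.exp s + pC.eval s * Real.exp (2 * s) = 0) ∨
      ({s : ℝ | pA.eval s + pB.eval s * Real.exp s + pC.eval s * Real.exp (2 * s) = 0}.Finite ∧
        {s : ℝ | pA.eval s + pB.eval s * Real.exp s + pC.eval s * Real.exp (2 * s) = 0}.ncard ≤
          ((if pA = 0 then 0 else pA.natDegree + 1) + (if pB = 0 then 0 else pB.natDegree + 1) + (if pC = 0 then 0 else pC.natDegree + 1)) - 1) := by
  have h := Braess1986_VI_1_1_extended_holds 3 ![pA, pB, pC] ![0, 1, 2]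
  have hsum : ∀ s : ℝ, ∑ ν : Fin 3, ((![pA, pB, pC] : Fin 3 → ℝ[X]) ν).eval s * Real.exp ((![(0 : ℝ), 1, 2] : Fin 3 → ℝ) ν * s)
      = pA.eval s + pB.eval s * Real.exp s + pC.eval s * Real.exp (2 * s) := by
    intro s
    rw [Fin.sum_univ_three]
    simp only [Matrix.cons_val_zero, Matrix.cons_val_one, Matrix.cons_val_two, Matrix.tail_cons, Matrix.head_cons, zero_mul, Real.exp_zero, mul_one,
      one_mul]
  have hord : (∑ ν : Fin 3, if (![pA, pB, pC] : Fin 3 → ℝ[X]) ν = 0 then 0 else ((![pA, pB, pC] : Fin 3 → ℝ[X]) ν).natDegree + 1)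
      = (if pA = 0 then 0 else pA.natDegree + 1) + (if pB = 0 then 0 else pB.natDegree + 1) + (if pC = 0 then 0 else pC.natDegree + 1) := by
    rw [Fin.sum_univ_three]
    simp only [Matrix.cons_val_zero, Matrix.cons_val_one, Matrix.cons_val_two, Matrix.tail_cons, Matrix.head_cons]
  simp only [hsum] at h
  rw [hord] at h
  exact h

/-- **The generic junction has at most two roots.**  For non-zero reals `a, b, c`, `s ↦ a + b·e^{s} + c·e^{2s}` has a finite zero set with at most `2` elements
(a quadratic in `e^s`; here read off `junctionCluster_zeros_le`). [folklore] -/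
theorem junctionCluster_const_zeros_le_two (a b c : ℝ) (ha : a ≠ 0) (hb : b ≠ 0) (hc : c ≠ 0) :
    {s : ℝ | a + b * Real.exp s + c * Real.exp (2 * s) = 0}.Finite ∧ {s : ℝ | a + b * Real.exp s + c * Real.exp (2 * s) = 0}.ncard ≤ 2 := by
  have h := junctionCluster_zeros_le (C a) (C b) (C c)
  simp only [eval_C, map_eq_zero, ha, hb, hc, if_false, natDegree_C, zero_add] at h
  rcases h with h0 | h
  · -- identically zero is impossible for non-zero constants: the values at s = 0, 1, 2 form a Vandermonde system in E = e
    exfalso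
    set E := Real.exp 1 with hE
    have hE1 : 1 < E := by rw [hE]; exact Real.one_lt_exp_iff.mpr one_pos
    have hx2 : Real.exp 2 = E * E := by rw [hE, ← Real.exp_add]; norm_num
    have hx4 : Real.exp (2 * 2) = E * E * (E * E) := by rw [show (2 : ℝ) * 2 = 2 + 2 by norm_num, Real.exp_add, hx2]
    have h1 := h0 0
    have h2 := h0 1
    have h3 := h0 2
    rw [mul_zero, Real.exp_zero, mul_one, mul_one] at h1
    rw [mul_one, hx2, ← hE] at h2
    rw [hx2, hx4] at h3
    -- b(E−1) = −c(E−1)(E+1) and b(E²−1) = −c(E²−1)(E²+1)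
    have hb1 : b = -c * (E + 1) := by
      have : (E - 1) * (b + c * (E + 1)) = 0 := by linear_combination h2 - h1
      rcases mul_eq_zero.1 this with h | h
      · linarith
      · linarith
    have hb2 : b = -c * (E * E + 1) := by
      have : (E * E - 1) * (b + c * (E * E + 1)) = 0 := by linear_combination h3 - h1
      rcases mul_eq_zero.1 this with h | h
      · nlinarith
      · linarith
    have hc0 : c * (E * (E - 1)) = 0 := by linear_combination hb2 - hb1
    rcases mul_eq_zero.1 hc0 with h | h
    · exact hc h
    · rcases mul_eq_zero.1 h with h' | h'
      · linarith
      · linarith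
  · simpa using h

end Summit.ValiantsHypothesis.ValiantsHypothesis.Theorems.LacunarySymmetroidMatrixDescartes.Census
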